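import Mathlib
import Summits.KontsevichZagierPeriods.Zeta5Search.Families.RayGrowthTransport
import Summits.KontsevichZagierPeriods.Zeta5Search.Families.BasicGrowthScaling
import HarnessLib

/-!
# ζ(5) search — Families: weak duality for RAYS with real weighted plans — `F(t) ∏ β^β ≤ ∏ x^x`

HONEST FRAMING: systematic search; no irrationality claim unless certified.  STRUCTURAL facts about the size of
Brown's generalised cellular integrals along a ray [Brown2016, §5.2; BrownZudilin2022, (1)–(3)] (seat P2, Families
layer); nothing about the arithmetic of any zeta value.

`Families/RayGrowthTransport.lean` proved the INTEGER transport certificate `M_σ(α,β)^q ∏ (qβ_i)^{qβ_i} ≤ ∏ p^p`.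
This file proves the REAL-plan version (the weighted analogue of `Families/BasicGrowthEntropy.lean`):
* `rpow_mul_prod_rpow_le` — real-weight AM–GM in product form, `X^X ∏ y^x ≤ (Σ y)^X ∏ x^x` (`X = Σ x`);
* `num_eq_prod_gapN_zpow` — `num α t = ∏_w g_w^{α_w}`;
* **`rayF_mul_le_of_realTransport`** — for a bijective seating and a real plan `x ≥ 0` supported on (finite
  `σδ⁰`-edge, spanned gap) with row sums `β_i` and column sums `α_w`: `F(t) · ∏_i (Σ_w x)^{Σ_w x} ≤ ∏ x^x`;
* **`raySup_mul_le_of_realTransport`** — hence `M_σ(α,β) · ∏_i β_i^{β_i} ≤ ∏ x^x` (homogeneous ray in Brown's cone).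
The exactness certificate built on it is `Families/RayGrowthScaling.lean`.  Standard axioms only.
-/

noncomputable section

open MeasureTheory Set Finset Filter Topology

namespace Summit.KontsevichZagierPeriods.Zeta5Search.Families.Cellular

variable {ℓ : ℕ} (σ : Fin (ℓ + 3) → Fin (ℓ + 3)) (α β : Fin (ℓ + 3) → ℤ)

/-! ### Real-weight AM–GM in product form -/

/-- **`X^X · ∏_{w∈s} y_w^{x_w} ≤ (Σ_{w∈s} y_w)^X · ∏_{w∈s} x_w^{x_w}`** for positive weights `x` on a nonempty `s`,
`X = Σ_{w∈s} x_w`, and `y ≥ 0` (weighted AM–GM at the points `y_w X / x_w`). -/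
theorem rpow_mul_prod_rpow_le {ι : Type*} (s : Finset ι) (x y : ι → ℝ) (hx : ∀ w ∈ s, 0 < x w)
    (hy : ∀ w ∈ s, 0 ≤ y w) (hne : s.Nonempty) :
    (∑ w ∈ s, x w) ^ (∑ w ∈ s, x w) * ∏ w ∈ s, y w ^ x w ≤
      (∑ w ∈ s, y w) ^ (∑ w ∈ s, x w) * ∏ w ∈ s, x w ^ x w := by
  have hXpos : 0 < ∑ v ∈ s, x v := Finset.sum_pos hx hne
  have hz : ∀ w ∈ s, 0 ≤ y w * (∑ v ∈ s, x v) / x w :=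
    fun w hw => div_nonneg (mul_nonneg (hy w hw) hXpos.le) (hx w hw).le
  -- weighted AM–GM with weights `x/X` at the points `y X / x`
  have amgm := Real.geom_mean_le_arith_mean_weighted s (fun w => x w / ∑ v ∈ s, x v)
    (fun w => y w * (∑ v ∈ s, x v) / x w)
    (fun w hw => (div_pos (hx w hw) hXpos).le)
    (by rw [← Finset.sum_div, div_self hXpos.ne'])
    hz
  have hR : ∑ w ∈ s, x w / (∑ v ∈ s, x v) * (y w * (∑ v ∈ s, x v) / x w) = ∑ w ∈ s, y w := by
    refine Finset.sum_congr rfl fun w hw => ?_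
    field_simp [(hx w hw).ne', hXpos.ne']
  rw [hR] at amgm
  -- raise to the power `X`
  have hL0 : 0 ≤ ∏ w ∈ s, (y w * (∑ v ∈ s, x v) / x w) ^ (x w / ∑ v ∈ s, x v) :=
    Finset.prod_nonneg fun w hw => Real.rpow_nonneg (hz w hw) _
  have h1 := Real.rpow_le_rpow hL0 amgm hXpos.le
  rw [← Real.finsetProd_rpow _ _ (fun w hw => Real.rpow_nonneg (hz w hw) _)] at h1
  have h2 : ∏ w ∈ s, ((y w * (∑ v ∈ s, x v) / x w) ^ (x w / ∑ v ∈ s, x v)) ^ (∑ v ∈ s, x v) =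
      ∏ w ∈ s, (y w * (∑ v ∈ s, x v) / x w) ^ x w := by
    refine Finset.prod_congr rfl fun w hw => ?_
    rw [← Real.rpow_mul (hz w hw), div_mul_cancel₀ _ hXpos.ne']
  rw [h2] at h1
  -- `∏ (y X / x)^x = ∏ y^x · X^X / ∏ x^x`
  have h3 : ∏ w ∈ s, (y w * (∑ v ∈ s, x v) / x w) ^ x w =
      (∏ w ∈ s, y w ^ x w) * (∑ v ∈ s, x v) ^ (∑ w ∈ s, x w) / ∏ w ∈ s, x w ^ x w := by
    rw [Real.rpow_sum_of_pos hXpos (fun w => x w) s, ← Finset.prod_mul_distrib, ← Finset.prod_div_distrib]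
    refine Finset.prod_congr rfl fun w hw => ?_
    rw [Real.div_rpow (mul_nonneg (hy w hw) hXpos.le) (hx w hw).le, Real.mul_rpow (hy w hw) hXpos.le]
  rw [h3, div_le_iff₀ (Finset.prod_pos fun w hw => Real.rpow_pos_of_pos (hx w hw) _)] at h1
  linarith [h1]

/-! ### The numerator and denominator of `F` in gap / edge-length form -/

/-- `num α t = ∏_w gapN t w ^ α_w` (the two `δ⁰`-edges through `∞` contribute `1`). -/
theorem num_eq_prod_gapN_zpow (t : Fin ℓ → ℝ) :
    num α t = ∏ w : Fin (ℓ + 1), gapN t w ^ α ⟨w.val, by omega⟩ := by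
  unfold num
  rw [Fin.prod_univ_castSucc, Fin.prod_univ_castSucc]
  have e1 : ef t (Fin.last (ℓ + 2)) (Fin.last (ℓ + 2) + 1) = 1 :=
    ef_succ_of_gt t _ (by rw [Fin.val_last]; omega)
  have e2 : ef t (Fin.castSucc (Fin.last (ℓ + 1))) (Fin.castSucc (Fin.last (ℓ + 1)) + 1) = 1 :=
    ef_succ_of_gt t _ (by rw [Fin.val_castSucc, Fin.val_last]; omega)
  rw [e1, e2, one_zpow, one_zpow, mul_one, mul_one]
  refine Finset.prod_congr rfl fun w _ => ?_
  have hw : (Fin.castSucc (Fin.castSucc w) : Fin (ℓ + 3)).val ≤ ℓ := by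
    rw [Fin.val_castSucc, Fin.val_castSucc]; omega
  rw [ef_succ_of_le t _ hw]
  have hg : pt t ((Fin.castSucc (Fin.castSucc w) : Fin (ℓ + 3)).val + 1) -
      pt t (Fin.castSucc (Fin.castSucc w) : Fin (ℓ + 3)).val = gapN t w := by
    simp only [Fin.val_castSucc, gapN]
  rw [hg]
  have hc : (⟨w.val, by omega⟩ : Fin (ℓ + 3)) = Fin.castSucc (Fin.castSucc w) := Fin.ext (by simp)
  rw [hc]

/-! ### Weak duality for real weighted plans -/

/-- **Weak duality for rays (real weighted plans).**  For a bijective seating, integer exponents `α, β` and a real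
plan `x ≥ 0` supported on (finite `σδ⁰`-edge `i`, gap `w` in its span) with row sums `β_i` on the finite edges and
column sums `α_w`: `F(t) · ∏_i β_i^{β_i} ≤ ∏_{i,w} x(i,w)^{x(i,w)}` on the open simplex (product over the finite
edges of `(β_i : ℝ)^(β_i : ℝ)`). -/
theorem rayF_mul_le_of_realTransport (hσ : Function.Bijective σ) (x : Fin (ℓ + 3) → Fin (ℓ + 1) → ℝ)
    (hx : ∀ i w, 0 ≤ x i w)
    (hsupp : ∀ i w, x i w ≠ 0 → ((σ i).val ≠ ℓ + 2 ∧ (σ (i + 1)).val ≠ ℓ + 2) ∧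
      min (σ i).val (σ (i + 1)).val ≤ w.val ∧ w.val < max (σ i).val (σ (i + 1)).val)
    (hrow : ∀ i, ((σ i).val ≠ ℓ + 2 ∧ (σ (i + 1)).val ≠ ℓ + 2) → ∑ w, x i w = β i)
    (hcol : ∀ w : Fin (ℓ + 1), ∑ i, x i w = α ⟨w.val, by omega⟩)
    {t : Fin ℓ → ℝ} (ht : t ∈ openSimplex ℓ) :
    rayF σ α β t * ∏ i, (∑ w, x i w) ^ (∑ w, x i w) ≤ ∏ i, ∏ w, x i w ^ x i w := by
  classical
  have hpos := (mem_openSimplex_iff_gapN t).1 ht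
  set L : Fin (ℓ + 3) → ℝ := fun i => ef t (σ i) (σ (i + 1)) with hL
  have hLpos : ∀ i, 0 < L i := fun i => ef_pos ht fun h => succ_ne_self i (hσ.1 h)
  -- (A) `den = ∏_i L_i ^ (Σ_w x i w)` as real powers
  have hden : den σ β t = ∏ i, L i ^ (∑ w, x i w) := by
    unfold den
    refine Finset.prod_congr rfl fun i _ => ?_
    by_cases hfin : (σ i).val ≠ ℓ + 2 ∧ (σ (i + 1)).val ≠ ℓ + 2
    · show L i ^ β i = L i ^ (∑ w, x i w)
      rw [hrow i hfin, Real.rpow_intCast]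
    · have h1 : L i = 1 := by
        simp only [hL]
        exact ef_sigma_of_infinite σ t i hfin
      show L i ^ β i = L i ^ (∑ w, x i w)
      rw [h1, one_zpow, Real.one_rpow]
  have hdenpos : 0 < den σ β t := Finset.prod_pos fun i _ => zpow_pos (hLpos i) _
  -- (B) `num = ∏_w g_w ^ (Σ_i x i w)`
  have hnum : num α t = ∏ w : Fin (ℓ + 1), gapN t w ^ (∑ i, x i w) := by
    rw [num_eq_prod_gapN_zpow]
    refine Finset.prod_congr rfl fun w _ => ?_
    rw [hcol w, Real.rpow_intCast]
  -- (C) per position: `X^X ∏_w g^x ≤ L_i^X ∏_w x^x`, `X = Σ_w x i w`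
  have hstep : ∀ i, (∑ w, x i w) ^ (∑ w, x i w) * ∏ w : Fin (ℓ + 1), gapN t w ^ x i w ≤
      L i ^ (∑ w, x i w) * ∏ w, x i w ^ x i w := by
    intro i
    set s := univ.filter fun w : Fin (ℓ + 1) => x i w ≠ 0 with hs
    have hmem : ∀ w, w ∈ s ↔ x i w ≠ 0 := fun w => by simp [hs]
    have hsum_s : ∑ w ∈ s, x i w = ∑ w, x i w := by rw [hs, Finset.sum_filter_ne_zero]
    have h1 : ∏ w ∈ s, gapN t w ^ x i w = ∏ w : Fin (ℓ + 1), gapN t w ^ x i w := by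
      refine Finset.prod_subset (Finset.filter_subset _ _) fun w _ hw => ?_
      have : x i w = 0 := by by_contra h; exact hw ((hmem w).2 h)
      rw [this, Real.rpow_zero]
    have h2 : ∏ w ∈ s, x i w ^ x i w = ∏ w, x i w ^ x i w := by
      refine Finset.prod_subset (Finset.filter_subset _ _) fun w _ hw => ?_
      have : x i w = 0 := by by_contra h; exact hw ((hmem w).2 h)
      rw [this, Real.rpow_zero]
    rcases s.eq_empty_or_nonempty with hse | hsne
    · have h0 : ∑ w, x i w = 0 := by
        rw [← hsum_s, hse, Finset.sum_empty]
      rw [h0, Real.rpow_zero, Real.rpow_zero, ← h1, ← h2, hse, Finset.prod_empty, Finset.prod_empty]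
    · have hxs : ∀ w ∈ s, 0 < x i w := fun w hw => lt_of_le_of_ne (hx i w) (Ne.symm ((hmem w).1 hw))
      have key := rpow_mul_prod_rpow_le s (x i) (fun w => gapN t w) hxs (fun w _ => (hpos w).le) hsne
      rw [hsum_s, h1, h2] at key
      obtain ⟨w0, hw0⟩ := hsne
      have hfin := (hsupp i w0 ((hmem w0).1 hw0)).1
      have h3 : ∑ w ∈ s, gapN t w ≤ L i := by
        have hlen : L i = (cellEdges σ hσ.1).len t (Sum.inr ⟨i, hfin⟩) := by
          simp only [hL, ef_sigma_of_finite σ t i hfin]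
          rfl
        rw [hlen, (cellEdges σ hσ.1).len_eq_sum_gap]
        refine Finset.sum_le_sum_of_subset_of_nonneg (fun w hw => ?_) fun w _ _ => (hpos w).le
        have hw' : x i w ≠ 0 := (hmem w).1 hw
        rw [EdgeFamily.mem_span]
        simp only [cellEdges, Sum.elim_inr]
        exact (hsupp i w hw').2
      have hX0 : 0 ≤ ∑ w, x i w := Finset.sum_nonneg fun w _ => hx i w
      calc (∑ w, x i w) ^ (∑ w, x i w) * ∏ w : Fin (ℓ + 1), gapN t w ^ x i w
          ≤ (∑ w ∈ s, gapN t w) ^ (∑ w, x i w) * ∏ w, x i w ^ x i w := key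
        _ ≤ L i ^ (∑ w, x i w) * ∏ w, x i w ^ x i w :=
          mul_le_mul_of_nonneg_right
            (Real.rpow_le_rpow (Finset.sum_nonneg fun w _ => (hpos w).le) h3 hX0)
            (Finset.prod_nonneg fun w _ => Real.rpow_nonneg (hx i w) _)
  -- (D) multiply over the positions
  have hprod := Finset.prod_le_prod (s := (univ : Finset (Fin (ℓ + 3))))
    (fun i _ => mul_nonneg (Real.rpow_nonneg (Finset.sum_nonneg fun w _ => hx i w) _)
      (Finset.prod_nonneg fun w _ => Real.rpow_nonneg (hpos w).le _))
    fun i _ => hstep i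
  rw [Finset.prod_mul_distrib, Finset.prod_mul_distrib] at hprod
  have hswap : ∏ i, ∏ w : Fin (ℓ + 1), gapN t w ^ x i w = num α t := by
    rw [hnum, Finset.prod_comm]
    refine Finset.prod_congr rfl fun w _ => ?_
    rw [Real.rpow_sum_of_pos (hpos w)]
  rw [hswap, ← hden] at hprod
  unfold rayF
  rw [div_mul_eq_mul_div, div_le_iff₀ hdenpos]
  calc num α t * ∏ i, (∑ w, x i w) ^ (∑ w, x i w)
      = (∏ i, (∑ w, x i w) ^ (∑ w, x i w)) * num α t := mul_comm _ _
    _ ≤ den σ β t * ∏ i, ∏ w, x i w ^ x i w := hprod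
    _ = (∏ i, ∏ w, x i w ^ x i w) * den σ β t := mul_comm _ _

variable (hσ : Function.Bijective σ) (hh : Homogeneous σ α β)
  (hray : ∀ N : ℤ, 0 ≤ N → BrownConvergent σ (fun i => N * α i) (fun i => N * β i))

include hσ in
/-- **Weak duality for the growth constant of a ray**: `M_σ(α,β) · ∏_i (Σ_w x)^{Σ_w x} ≤ ∏ x^x` for every plan as in
`rayF_mul_le_of_realTransport`. -/
theorem raySup_mul_le_of_realTransport (x : Fin (ℓ + 3) → Fin (ℓ + 1) → ℝ) (hx : ∀ i w, 0 ≤ x i w)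
    (hsupp : ∀ i w, x i w ≠ 0 → ((σ i).val ≠ ℓ + 2 ∧ (σ (i + 1)).val ≠ ℓ + 2) ∧
      min (σ i).val (σ (i + 1)).val ≤ w.val ∧ w.val < max (σ i).val (σ (i + 1)).val)
    (hrow : ∀ i, ((σ i).val ≠ ℓ + 2 ∧ (σ (i + 1)).val ≠ ℓ + 2) → ∑ w, x i w = β i)
    (hcol : ∀ w : Fin (ℓ + 1), ∑ i, x i w = α ⟨w.val, by omega⟩) :
    raySup σ α β * ∏ i, (∑ w, x i w) ^ (∑ w, x i w) ≤ ∏ i, ∏ w, x i w ^ x i w := by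
  have hC : 0 ≤ ∏ i, (∑ w, x i w) ^ (∑ w, x i w) :=
    Finset.prod_nonneg fun i _ => Real.rpow_nonneg (Finset.sum_nonneg fun w _ => hx i w) _
  rcases hC.eq_or_lt with hC0 | hCpos
  · rw [← hC0, mul_zero]
    exact Finset.prod_nonneg fun i _ => Finset.prod_nonneg fun w _ => Real.rpow_nonneg (hx i w) _
  rw [← le_div_iff₀ hCpos]
  refine csSup_le ((openSimplex_nonempty ℓ).image _) ?_
  rintro _ ⟨t, ht, rfl⟩
  rw [le_div_iff₀ hCpos]
  exact rayF_mul_le_of_realTransport σ α β hσ x hx hsupp hrow hcol ht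

end Summit.KontsevichZagierPeriods.Zeta5Search.Families.Cellular
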